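import Summits.QuantumFields.QCD.Theorems.GluonicCompletion.Negative.Reweighting
import Literature.MathematicalPhysics.QuantumLattice.WilsonPositivityDomain
import Literature.MathematicalPhysics.QuantumFieldTheory.QCDHeavyQuarkPropagator

/-!
# `PauliWegnerSea.OneScaleTrajectory` (crux stmt-QuantumFields-11513), line `threshold-tuned-witness` —
# registered stub `stub_signPos`: clause (iv) is FREE at positive bare masses (Seiler's positivity domain)

Lead's reshape (cycle 2, prover-line-stmt-QuantumFields-11513-1) of the planner's `stub_sign`
(clause (iv), sign coherence `½ ≤ ‖∫ det D‖ / ∫ ‖det D‖` for the window tuples of the threshold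
witness): the stub is split by the sign of the bare masses. THIS half is a theorem of the tree:
for a bare tuple `t` with every component `> 0`, `det (diracMatrix U t) = ∏_f det D_W(U, t_f, 1)` is a
product of POSITIVE reals for every `SU(3)` field (`fermionDet_wilsonDirac_re_pos`, Seiler 1982 apud
Rothe 2005 Ch. 12, landed as `Literature/MathematicalPhysics/QuantumLattice/WilsonPositivityDomain.lean`),
so the signed and the phase-quenched partition functions coincide and the ratio is `1`
(`GluonicCompletion.Negative.signRatio_eq_one_of_det_re_nonneg`). Stated in tree vocabulary only, for
every `N_f`, every coupling `β`, every torus half-side `S` — the form the skeleton's `composition` consumes.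
The other half (`stub_signNonpos`: some component `≤ 0`, the supercritical side where the
physics of the line lives) stays registered and open.
-/

noncomputable section

namespace Summit.QuantumFields.QCD.Cruxes.OneScaleTrajectory.ThresholdTunedWitness

open MeasureTheory
open Literature.MathematicalPhysics.QuantumFieldTheory Literature.MathematicalPhysics.QuantumLattice
  Literature.Probability.LatticeModels

/-- For positive bare masses the `N_f`-flavour Wilson determinant has POSITIVE real part for every
gauge field: `0 < Re det (diracMatrix U t) = ∏_f Re det D_W(U, t_f, 1)` (Seiler positivity flavour by
flavour). -/
theorem det_diracMatrix_re_pos_of_pos {Nf S : ℕ} [NeZero S] (U : GaugeConfig 4 S SU3)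
    (t : Fin Nf → ℝ) (ht : ∀ f, 0 < t f) : 0 < ((diracMatrix U t).det).re := by
  have hρ : ∀ g, fundamentalRep (Fin 3) g ∈ Matrix.unitaryGroup (Fin 3) ℂ :=
    fun g => fundamentalRep_mem_unitaryGroup g
  have hre : ∀ f, fermionDet (wilsonDirac (fundamentalRep (Fin 3)) U (t f) 1) =
      (((fermionDet (wilsonDirac (fundamentalRep (Fin 3)) U (t f) 1)).re : ℝ) : ℂ) := fun f =>
    fermionDet_wilsonDirac_eq_ofReal_of_mass_pos (L := S) (fundamentalRep (Fin 3)) hρ U (t f)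
  rw [det_diracMatrix, Finset.prod_congr rfl fun f _ => hre f, ← Complex.ofReal_prod,
    Complex.ofReal_re]
  exact Finset.prod_pos fun f _ => fermionDet_wilsonDirac_re_pos (L := S) (fundamentalRep (Fin 3)) hρ U (ht f)

/-- `stub_signPos` — **CLAUSE (iv) AT POSITIVE BARE MASSES** (registered stub of line
`threshold-tuned-witness`, tree vocabulary): for every `N_f`, coupling `β`, torus half-side `S` and
bare tuple `t` with all components `> 0`, the sign-coherence ratio of clause (iv) is at least `½` — in
fact it equals `1`, since `det (diracMatrix U t) > 0` for every field (Seiler's positivity domain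
`κ < 1/8`), so `∫ det = ∫ ‖det‖ > 0`. -/
theorem stub_signPos :
    ∀ (Nf : ℕ) (β : ℝ) (S : ℕ) (t : Fin Nf → ℝ), (∀ f, 0 < t f) →
      (1 / 2 : ℝ) ≤
        ‖∫ U : GaugeConfig 4 (2 * S + 1) (Matrix.specialUnitaryGroup (Fin 3) ℂ),
            (diracMatrix U t).det ∂(wilsonMeasure (fundamentalRep (Fin 3)) β)‖ /
          (∫ U : GaugeConfig 4 (2 * S + 1) (Matrix.specialUnitaryGroup (Fin 3) ℂ),
            ‖(diracMatrix U t).det‖ ∂(wilsonMeasure (fundamentalRep (Fin 3)) β)) := by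
  intro Nf β S t ht
  have h1 := Summit.QuantumFields.QCD.Theorems.GluonicCompletion.Negative.signRatio_eq_one_of_det_re_nonneg
    (S := 2 * S + 1) β t (fun U => (det_diracMatrix_re_pos_of_pos U t ht).le)
    (Filter.Eventually.of_forall fun U => det_diracMatrix_ne_zero_of_pos U t ht)
  rw [h1]
  norm_num

end Summit.QuantumFields.QCD.Cruxes.OneScaleTrajectory.ThresholdTunedWitness

end
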